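import Mathlib
import Summits.Ventures.PercRepro2.M9LatticeHarris
import Summits.Ventures.PercRepro2.M9QuadHarris

/-!
# The quad inequality for the sharpened crux (blind cell PercRepro2, p3 g35, 2026-08-29;
`proofs/P3-NPHDR.md` §5′)

The same hypercube data as `M9QuadHarris` (`ℓ` the link indicator of the `Y`-side set,
`HY ≤ HW` the `p ~_Y q` counts of the two extreme co-fibres of a quad), now with the CLEAN
`K`-points removed from the one-sided part: `N₂` counts the dead patterns whose `K`-point still
has a `Y`-link, and the counting of §5′(c′) gives `N₂ ≥ 2·ℓ univ` whenever the doubly-reached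
part is non-zero.  **The 2EXHD quad inequality** (`quad_two_ex_hd_nonpos`): under
`ℓ univ = 1 → 2 ≤ N₂`, `2·Σ_{∅ ≠ S ≠ univ} (1 − ℓ S)(HY S − HW Sᶜ) + N₂·(HY ∅ − HW univ) ≤ 0`.
The proof is the one of `quad_sum_nonpos` with the one-sided bound `N₂·(HY ∅ − HW univ) ≤
2·ℓ univ·(HW ∅ − HW univ)`, after which Harris on the full cube closes at once.  Own work;
std axioms.
-/

namespace Summit.Ventures.PercRepro2

namespace M9Reduce

open Finset

variable {ι : Type*} [Fintype ι] [DecidableEq ι]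

/-- **The 2EXHD quad inequality.** -/
theorem quad_two_ex_hd_nonpos [Nonempty ι] {ℓ HY HW : Finset ι → ℤ} (hℓ : Monotone ℓ)
    (hℓ0 : ∀ S, 0 ≤ ℓ S) (hℓ1 : ∀ S, ℓ S ≤ 1) (hℓe : ℓ ∅ = 0) (hW : Monotone HW)
    (hYW : ∀ S, HY S ≤ HW S) {N₂ : ℤ} (hN₂0 : 0 ≤ N₂) (hN₂ : ℓ univ = 1 → 2 ≤ N₂) :
    2 * (∑ S ∈ (proper : Finset (Finset ι)), (1 - ℓ S) * (HY S - HW Sᶜ)) +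
      N₂ * (HY ∅ - HW univ) ≤ 0 := by
  -- Step 1: `HY ≤ HW` in the doubly-reached part
  have h1 : ∑ S ∈ (proper : Finset (Finset ι)), (1 - ℓ S) * (HY S - HW Sᶜ) ≤
      ∑ S ∈ (proper : Finset (Finset ι)), (1 - ℓ S) * (HW S - HW Sᶜ) := by
    refine Finset.sum_le_sum (fun S _ => ?_)
    have := hℓ1 S
    have := hYW S
    nlinarith
  -- Step 2: antisymmetry turns `(1 − ℓ)` into `−ℓ`
  have h2 : ∑ S ∈ (proper : Finset (Finset ι)), (1 - ℓ S) * (HW S - HW Sᶜ) =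
      ∑ S ∈ (proper : Finset (Finset ι)), ℓ S * (HW Sᶜ - HW S) := by
    have hz := sum_proper_sub_compl (ι := ι) HW
    have : ∑ S ∈ (proper : Finset (Finset ι)), (1 - ℓ S) * (HW S - HW Sᶜ) =
        ∑ S ∈ (proper : Finset (Finset ι)), (HW S - HW Sᶜ) +
          ∑ S ∈ (proper : Finset (Finset ι)), ℓ S * (HW Sᶜ - HW S) := by
      rw [← Finset.sum_add_distrib]
      refine Finset.sum_congr rfl (fun S _ => ?_)
      ring
    rw [this, hz, zero_add]
  -- Step 3: the dirty one-sided part pays `2 ℓ univ` units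
  have hneg : HY ∅ - HW univ ≤ 0 := by
    have := hYW ∅
    have := hW (Finset.empty_subset (univ : Finset ι))
    linarith
  have hnegW : HW ∅ - HW univ ≤ 0 := by
    have := hW (Finset.empty_subset (univ : Finset ι))
    linarith
  have h3 : N₂ * (HY ∅ - HW univ) ≤ 2 * ℓ univ * (HW ∅ - HW univ) := by
    have hYW0 := hYW ∅
    have hu0 := hℓ0 univ
    have hu1 := hℓ1 univ
    rcases Int.le_iff_lt_or_eq.1 hu1 with hlt | heq
    · -- `ℓ univ = 0`
      have h0 : ℓ univ = 0 := by omega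
      rw [h0]
      nlinarith
    · have h2N := hN₂ heq
      rw [heq]
      nlinarith
  -- Step 4: Harris on the full cube
  have hall : ∑ S : Finset ι, ℓ S * (HW Sᶜ - HW S) =
      ∑ S ∈ (proper : Finset (Finset ι)), ℓ S * (HW Sᶜ - HW S) + ℓ univ * (HW ∅ - HW univ) := by
    have hu : (univ : Finset ι) ∉ (proper : Finset (Finset ι)) := by
      rw [mem_proper]; tauto
    have he : (∅ : Finset ι) ∉ insert (univ : Finset ι) (proper : Finset (Finset ι)) := by
      simp only [Finset.mem_insert, mem_proper, not_or]
      exact ⟨Finset.univ_nonempty.ne_empty.symm, fun h => h.1 rfl⟩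
    have hcover : (univ : Finset (Finset ι)) =
        insert (∅ : Finset ι) (insert (univ : Finset ι) (proper : Finset (Finset ι))) := by
      ext S
      simp only [Finset.mem_univ, Finset.mem_insert, mem_proper, true_iff]
      tauto
    rw [hcover, Finset.sum_insert he, Finset.sum_insert hu, hℓe]
    simp only [zero_mul, zero_add, Finset.compl_univ]
    ring
  have hH := sum_link_mul_sub_nonpos hℓ hW
  rw [hall] at hH
  nlinarith [h1, h2, h3, hH]

end M9Reduce

end Summit.Ventures.PercRepro2
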